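import Mathlib
import HarnessLib
import HarnessLib.Audit
import Summits.Parity.Statement

/-!
Route: QuarticRoots

CLOSED (retired) 2026-08-15T13:50:28Z by operator:999:1257524 — reason: not-a-thesis: assembly does not conclude the sub-problem Statement — note: D-0027 §2.1 audit (human 2026-08-15: routes that do not decide the summit are removed): the assembly concludes `QuarticRootsPrimeModuli`, not the sub-problem statement; a NEW conforming route may be opened from the same idea (generated `closes : … → _root_.BatemanHorn`).. The file is kept as the record of this route; refuted decls are indexed as negative knowledge (`ledger negatives`).

# Route QuarticRoots — ζ₈ is quadratic over ℚ(√2): DFI Type I/II for the roots of n⁴+1 and their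
equidistribution to prime moduli

Partial-result route realising card cyclotomic-roots-hilbert-dfi (spine). End statement (target,
rank 0) T =
QuarticRootsPrimeModuli: the roots ν of ν⁴ ≡ −1 (mod p) are equidistributed modulo primes, ∀ h ≠ 0:
Σ_{p≤P} Σ_ν e(hν/p) = o(P/log P) — the degree-4 case of the Duke–Friedlander–Iwaniec theorem (degree
2, 1995),
open for every polynomial of degree ≥ 3, and the prime-modulus Type-I input that every window
decomposition of
BatemanHorn for n⁴+1 lacks (the quartic twin of CubicRoots' stmt-Parity-0878). It suffices to show X
= X_I ∧ X_II,
the two inputs of DFI's own proof transposed to f = X⁴+1, for the Weyl sums ρ_h(n) = Σ_{ν mod n,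
ν⁴≡−1} e(hν/n):
X_I (QuarticTypeI) = power-saving linear forms along multiples at level x^{1/2−ε},
Σ_{d≤x^{1/2−ε}} sup_{y≤x/d} |Σ_{m≤y} ρ_h(dm)| ≤ C x^{1−δ}; X_II (QuarticTypeII) = power-saving
bilinear forms
Σ_{m∼M}Σ_{n∼N} α_m β_n ρ_h(mn) ≤ C(MN)^{1−η} in the balanced range M^δ ≤ N ≤ M. Vaughan's identity
(support VaughanGlue,
a theorem about arbitrary divisor-bounded sequences) gives X → T. The card's ENGINE for X: ζ₈ is
quadratic over
F = ℚ(√2), so (n, ν) ↔ (primitive ideal 𝔫 of ℤ[√2] of norm n, root A of the CM relative quadratic Y²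
− √2·Y + 1 mod 𝔫),
and DFI's Gauss/Bykovskii parametrisation, reciprocity (support RootReciprocity) and
Kloosterman/Kuznetsov machinery
are to be run over F. X does NOT imply BatemanHorn; the continuation is prose (§Assembly) plus the
rung
QuarticPrimeWindow (crux 4: prime moduli p ∈ [X, X^{1+δ}] in the narrow window ℓ ≤ X < p).
Lean: `(∀ h : ℤ, h ≠ 0 → ∀ ε : ℝ, 0 < ε → ∃ δ : ℝ, 0 < δ ∧ ∃ C : ℝ, ∀ x : ℝ, 2 ≤ x → ∀ y : ℕ → ℕ, (∀
d : ℕ, (y d : ℝ) ≤ x / d) → ∑ d ∈ Finset.Icc 1 ⌊x ^ (1 / 2 - ε)⌋₊, ‖∑ m ∈ Finset.Icc 1 (y d), ∑ ν ∈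
(Finset.range (d * m)).filter (fun ν : ℕ => d * m ∣ ν ^ 4 + 1), Complex.exp (2 * Real.pi * Complex.I
* (h * ν / (d * m) : ℂ))‖ ≤ C * x ^ (1 - δ)) ∧ (∀ h : ℤ, h ≠ 0 → ∀ δ : ℝ, 0 < δ → ∃ η : ℝ, 0 < η ∧ ∃
C : ℝ, ∀ M N : ℝ, 1 ≤ N → M ^ δ ≤ N → N ≤ M → ∀ α β : ℕ → ℂ, (∀ m, ‖α m‖ ≤ 1) → (∀ n, ‖β n‖ ≤ 1) →
‖∑ m ∈ Finset.Ioc ⌊M⌋₊ ⌊2 * M⌋₊, ∑ n ∈ Finset.Ioc ⌊N⌋₊ ⌊2 * N⌋₊, α m * β n * ∑ ν ∈ (Finset.range (m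
* n)).filter (fun ν : ℕ => m * n ∣ ν ^ 4 + 1), Complex.exp (2 * Real.pi * Complex.I * (h * ν / (m *
n) : ℂ))‖ ≤ C * (M * N) ^ (1 - η))`

## Assembly
Pure logic plus one bookkeeping fact: fix h ≠ 0 and apply VaughanGlue to c := ρ_h — |ρ_h(n)| ≤ ϱ(n)
≤ 4^{ω(n)} ≤ τ(n)²
(X⁴+1 has ≤ 4 simple roots mod p^a for odd p, ϱ(2) = 1, ϱ(4) = 0) — whose two hypotheses are
QuarticTypeI h and
QuarticTypeII h up to the cast ((d·m : ℕ) : ℂ) = d·m. Continuation beyond this route (prose, not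
items): T and
QuarticPrimeWindow are the prime-modulus inputs — d = p ∈ (x, x^{1+δ}], where μ(d) = −1 is constant
so the prime slice
of the Möbius tail Σ_{d ∣ n⁴+1, d > x^{1−η}} μ(d) log d is an UNSIGNED Type-I quantity — to
PolynomialMobius.PolyMobiusTail at k = 1, f = X⁴+1 (route-Parity-PolynomialMobius, whose Assembly
reaches _root_.BatemanHorn),
exactly as CubicRoots' 0878/0879 are for cubics; composite moduli and the cofactor side stay with
PolynomialMobius.

Rationale: WHY THIS LINE. The only prime-modulus equidistribution theorem for roots of polynomial congruences
is DukeFriedlanderIwaniec1995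
(deg 2, o(π(x)); Toth2000 all quadratics): Gauss correspondence (n = r²+s², ν = s/r) +
Bykovskii/Poincaré series on
Γ₀(d) ⇒ Prop. 1 (linear forms along multiples, level x^{1/2}); CRT twisting ⇒ Prop. 2 (bilinear
forms); sieve
Theorem S ⇒ primes (paper:url-c7638613861e pp.425–426, 435–438) — while for deg ≥ 3 even the density
of {ν/p} is
conditional on Bunyakovsky (Foo2010 = doi:10.4064/aa144-1-1 = arXiv:0906.1240), CubicRoots bets on
SL₃ dynamics for generic cubics, and for n⁴+1 the
resultant/geometry-of-numbers method reaches only P⁺(n⁴+1) ≥ X^{1+c} on a positive density of n, its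
authors asking
for 'résultats d'équirépartition efficace pour des formes de degré 4' (Delabreteche2015 =
doi:10.4064/aa169-3-2, Thm 1.2 and Rem. 2).
The card's move: for the 2-power cyclotomic/dihedral quartics the Gauss correspondence survives one
level up —
ζ₈ is quadratic over F = ℚ(√2) (h_F = h_{ℚ(ζ₈)} = 1), roots of X⁴+1 mod n ↔ roots of g = Y² − √2Y +
1 modulo
primitive ideals 𝔫 = (α² + √2αβ + β²) ⊂ ℤ[√2] (support TowerSplitting at primes), with an
𝒪_F-reciprocity
A/n̂ ≡ ūᾱ/β − α/(βn̂) (mod 𝒪_F) of exactly DFI's shape; imported area = GL₂ spectral theory over a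
real
quadratic field (Kuznetsov for Γ₀(𝔮) ⊂ SL₂(ℤ[√2]): Bruggeman–Miatello; Weil over ℤ[√2]/𝔟;
exceptional spectrum
θ = 7/64 over number fields: Blomer–Brumley arXiv:1003.0559), Bianchi groups over ℚ(√∓2) for X⁴ ± 2.
What the route adds to the card after reading DFI 1995: (a) the typed architecture X_I ∧ X_II ⇒ T by
Vaughan, so
each half is refutable on its own and the glue is a theorem; (b) recalibration — even in degree 2
the saving over
PRIME moduli is only logarithmic ('by no means could we do better', DFI p.425), so power savings are
asked only of
the Type I/II inputs; (c) the precise obstruction the engine must beat, recorded as QuarticTypeI's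
why-it-might-fail
and as the structural cheapest falsifier: the rational phase e(hν/n), ν ∈ ℤ, is the Hilbert-modular
phase
e(tr(ηA/n̂)) only at an 𝔫-DEPENDENT frequency η ≡ h·(tr n̂)⁻¹ (mod 𝔫) of size ≍ √n (ℤ ⊂ ℤ[√2]/𝔫 is a
half-dimensional slice; RootReciprocity is its coordinate shadow: modulus d ≍ √p, error O(p^{−1/2})
instead of
DFI's O(1/p)). Disjoint in mechanism and polynomial class from QuadraticRoots/UnimodularColumns (deg
2, GL₂/ℚ),
CubicRoots (deg 3, SL₃), PolynomialMobius (all f, no engine); negatives index empty.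

RANKED CRUXES. #0 QuarticRootsPrimeModuli (target) — the end statement T (card C1, qualitative): for
every integer h ≠ 0, Σ_{p ≤ P prime} Σ_{ν mod p, ν⁴ ≡ −1} e(hν/p) = o(P/log P) (Weyl's criterion for
the pairs (p, ν), whose number is ∼ π(P)). Degree-4 instance of DFI 1995; not the conjunct. (why it
might fail: DFI 1995 p.425: 'the problem for polynomials of higher degree seems to us to be very far
away'; for deg ≥ 3 even the density of {ν/p} is known only under Bunyakovsky (Foo2010); = the
Kowalski–Soundararajan prime-moduli conjecture at f = X⁴+1.) [DukeFriedlanderIwaniec1995,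
doi:10.4064/aa144-1-1, arXiv:2003.12965, Hooley1964, Toth2000]
#2 QuarticTypeI (crux) — DFI Proposition 1 transposed to X⁴+1 (the Type-I half of X): for every h ≠
0 and ε > 0 there are δ, C > 0 such that for x ≥ 2 and every cut-off function y with y(d) ≤ x/d:
Σ_{d ≤ x^{1/2−ε}} |Σ_{m ≤ y(d)} ρ_h(dm)| ≤ C x^{1−δ}, ρ_h(n) = Σ_{ν mod n, ν⁴≡−1} e(hν/n) —
power-saving equidistribution of the roots of X⁴+1 modulo n ≡ 0 (mod d) at level x^{1/2−ε} (trivial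
≍ x, heuristic x^{3/4}; numerics j000079 (C): T(x) ≈ x^{0.59} for x ≤ 10⁶). The engine's first
deliverable: over F the sum runs over primitive ideals 𝔫 ≡ 0 (mod 𝔮) of ℤ[√2] and roots of Y² − √2Y
+ 1. [difficulty: open-problem] (why it might fail: Hooley1964 saves only (log x)^-δ for deg ≥ 3, no
level; e(hν/n) is a Hilbert-modular phase over ℚ(√2) only at an 𝔫-dependent frequency ≍ √n (ν ∈ ℤ is
a half-dimensional slice of ℤ[√2]/𝔫): Kuznetsov over F would need uniformity in frequencies up to
√(modulus).) [DukeFriedlanderIwaniec1995, Hooley1964, doi:10.1093/imrn/rnr112, arXiv:2505.00493,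
HeathBrown2001LargestPrimeFactorCubic, arXiv:1003.0559]
#3 QuarticTypeII (crux) — DFI Proposition 2 transposed to X⁴+1, in the balanced range (the Type-II
half of X): for every h ≠ 0 and δ > 0 there are η, C > 0 such that for 1 ≤ N, M^δ ≤ N ≤ M and all
1-bounded coefficients α, β: |Σ_{M<m≤2M} Σ_{N<n≤2N} α_m β_n ρ_h(mn)| ≤ C (MN)^{1−η}. By CRT ρ_h(mn)
= Σ_{ν₁,ν₂} e(hν₁n̄/m) e(hν₂m̄/n) for (m,n) = 1: bilinear forms with root-weighted Kloosterman
fractions; DFI 1995 p.425 call ‖α‖‖β‖(M+N)^{1/2}(hMN)^ε 'plausible' and prove a shorter range with β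
on primes. [deps: QuarticTypeI] [difficulty: open-problem] (why it might fail: Even for n²+1 a power
saving in the balanced range N ≈ M is not in print (DFI 1995 Prop. 2: short N, β on primes; GM 2025
Thm 1.5: N ≤ X^1/4); the CRT reduction needs QuarticTypeI uniform in d ≤ x^(1−ε) and in twisted
frequencies h(n₂−n₁) ≤ x.) [DukeFriedlanderIwaniec1995, arXiv:2505.00493, arXiv:1502.00769,
KowalskiSoundararajan2021]
#4 QuarticPrimeWindow (crux) — card C2/C4, the consumable rung: there are δ, C > 0 such that for 2 ≤
X ≤ P ≤ X^{1+δ}: |Σ_{P<p≤2P prime} (#{1 ≤ ℓ ≤ X : p ∣ ℓ⁴+1} − X·ϱ(p)/p)| ≤ C X^{1−δ}, ϱ(p) = #{ν mod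
p : ν⁴ ≡ −1} (main term ≍ X/log X, fluctuation heuristic √X; numerics j000079 (B): within 2√main up
to P = X^{1.5}, X ≤ 10⁵). Equidistribution of ν/p at the shrinking scale X/P over PRIME moduli just
beyond X: the prime slice d = p ∈ (x, x^{1+δ}] of the Möbius tail of n⁴+1 (μ(p) = −1 constant ⇒
unsigned) and the Dickman-type law for P⁺(n⁴+1) near exponent 1. [deps: QuarticTypeI, QuarticTypeII]
[difficulty: open-problem] (why it might fail: Needs Weyl sums uniform in h ≤ P/X ≈ X^δ, where the
reciprocity error O(h·p^-1/2) bites, plus Type II to reach primes; for n⁴+1 only geometry of numbers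
goes beyond X (P⁺ ≥ X^(1+c) on a positive density, Delabreteche2015 Thm 1.2; Φ₁₂: c = 10^-26531) —
never prime moduli.) [doi:10.4064/aa169-3-2, arXiv:2505.00493,
HeathBrown2001LargestPrimeFactorCubic, DeshouillersIwaniec1982, MarklofWelsh2023]
#9 VaughanGlue (support) — sequence-agnostic glue (known method, provable with effort): for c : ℕ →
ℂ with |c(n)| ≤ τ(n)², Type I at level x^{1/2−ε} with a power saving (sup-over-length form) and Type
II with a power saving whenever M^δ ≤ N ≤ M imply Σ_{p≤P} c(p) = o(P/log P). Proof: Vaughan's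
identity with U = V = P^{δ₀} (in tree: Literature.NumberTheory.Sieve.VaughanMeanValueDecomposition,
vonMangoldt_eq_four_terms), Type I pieces by partial summation (level P^{2δ₀} ≤ P^{1/2−ε}), Type II
pieces after dyadic decomposition and Perron separation of mn ≤ P (twists m^{it}, n^{it} keep
coefficients 1-bounded), τ-bounds ≤ P^ε against the power saving, prime powers trivially, partial
summation from Λ to primes. [difficulty: L] [Vaughan1980, IwaniecKowalski2004,
DukeFriedlanderIwaniec1995]
#9 TowerSplitting (support) — the dictionary lemma at primes: in 𝔽_p with s² = 2, ν⁴ + 1 = 0 ↔ (ν² −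
sν + 1 = 0 ∨ ν² + sν + 1 = 0), from X⁴+1 = (X² − sX + 1)(X² + sX + 1); i.e. the roots of X⁴+1 mod p
≡ ±1 (8) are the roots of the CM relative quadratic g = Y² − √2·Y + 1 of ℚ(ζ₈)/ℚ(√2) read at the two
degree-one primes of ℤ[√2] above p (√2 ↦ ±s). Provable now (ring identity + no zero divisors).
[difficulty: provable-now] [doi:10.4064/aa169-3-2, Toth2000]
#9 RootReciprocity (support) — the card's reciprocity step as an exact identity: for ε = ±1, p =
ε(c² − 2d²) > 0, d ≠ 0, gcd(c, d) = 1, p ∣ dν − (dA₀ − cA₁) (i.e. ν ≡ A₀ + A₁√2 with √2 ≡ −c/d mod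
p) and c·c̄ ≡ 1 (mod d): ν/p ≡ A₀/p + ε·A₁·c̄/d − A₁c/(dp) (mod 1). With c + d√2 in a fixed
fundamental domain for the unit 1+√2 (|c|, |d| ≍ √p) and a short representative |Aᵢ| ≪ √p this is
ν/p = εA₁c̄/d + O(p^{−1/2}): a Kloosterman fraction of modulus d ≍ √p (DFI, n²+1: ν/p = −s̄/r +
O(1/p)). Checked numerically in-session (p = 17 = 5²−2·2², ν = 8, A = 2+√2; p = 7, ε = −1). Provable
now (two-term reciprocity d̄/p + p̄/d ≡ 1/(dp), p ≡ εc² mod d). [difficulty: provable-now]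
[DukeFriedlanderIwaniec1995, Toth2000]

TWO-LAYER PLAN. Foreseen glued splits (none filed now; k ≤ 3, depth 1). QuarticTypeI ⇐ (F-TypeI:
power-saving sums of the F-Weyl
sums Σ_{A mod 𝔫, g(A)≡0} e(tr(ηA/n̂)) over primitive ideals 𝔫 ≡ 0 (mod 𝔮) of ℤ[√2], UNIFORM in
F-frequencies
|η| ≤ (N𝔫)^{1/2+ε} — Kuznetsov over ℚ(√2) + Weil over ℤ[√2]/𝔟 + θ = 7/64) → (Bridge: e(hν/n) =
e(tr(η_𝔫 A/n̂)) with
η_𝔫 ≡ h(tr n̂)⁻¹ (mod 𝔫); RootReciprocity is its coordinate form) → QuarticTypeI. QuarticTypeII ⇐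
(CRT twist, DFI 1995
§5) → (QuarticTypeI uniform in d ≤ x^{1−ε} and |h| ≤ x) → QuarticTypeII. QuarticPrimeWindow ⇐
(narrow-window Type I
over ALL moduli: Σ_{d≤X^δ} |Σ_{k∼K, d∣k} (A_k(X) − ϱ(k)X/k)| ≤ X^{1−δ} for K ≤ X^{1+δ} — also the
Chebyshev input,
giving P⁺(n⁴+1) > X^{1+δ'} with a visible δ', and reachable as well by the geometry-of-numbers
variant on the factored
norm form N_{ℚ(ζ₈)/ℚ} = N_{F/ℚ} ∘ N_{K/F}) → (narrow-window Type II) → QuarticPrimeWindow (Harman /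
DFI Theorem S sieve).

KILL CRITERIA. QuarticRootsPrimeModuli refuted (a provable bias of ν/p for ν⁴ ≡ −1 over primes, or
|S_h(P)|/π(P) not decaying
numerically — j000079: square-root cancellation to 10⁷, j000172 runs to 3·10⁸) closes the route
`refuted:QuarticRootsPrimeModuli` (and, read through
Foo2010, is evidence against Bunyakovsky for n⁴+1 — report it loudly). QuarticTypeI refuted
(Ω(x^{1−ε}) for some h)
kills the engine and QuarticTypeII's CRT reduction: close. QuarticTypeII refuted alone: pivot —
restate with β
supported on primes and N ≤ x^{1/3} and replace VaughanGlue by DFI's Theorem S. ENGINE kill without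
refuting an
item: a refuter shows the √n-frequency obstruction (QuarticTypeI, why it might fail) cannot be met
by any
Kuznetsov-over-F argument (no gain over a generic S₄ quartic) AND the geometry-of-numbers variant
gives no visible
δ — close `exhausted` with that census. Mooted if CubicRoots-type dynamics or the
Kowalski–Soundararajan prime-moduli
conjecture is proved for all f (close superseded).

NOT DECOMPOSED YET. The F-side facts (Kuznetsov/Bruggeman–Miatello for Γ₀(𝔮) ⊂ SL₂(ℤ[√2]), Weil
bound over ℤ[√2]/𝔟, Blomer–Brumley
θ = 7/64) are NOT filed as cite items until the bridge child of QuarticTypeI is typed — they are the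
engine, not
hypotheses of any item, so the route's import cone has no unproved fact. Also left for later:
h-uniformity; the
siblings Φ₅, Φ₁₂, X⁴ ± 2 (same engine over ℚ(√5), ℚ(√3), ℚ(√∓2)); composite moduli in the window;
everything signed
(μ-twisted) — PolynomialMobius/CubicRoots territory; BatemanHorn for n⁴+1 itself.

CHEAPEST FALSIFIER. (i) Numerics, kit job j000079 (done; rerun to 3·10⁸ = j000172): Weyl sums S_h(P)
= Σ_{p≤P} ρ_h(p), h ≤ 6 — at
P = 10⁷ (N = 663904 pairs): |S_h|/√N ∈ [0.27, 2.04], |S_h|/N ≤ 0.25 %, star discrepancy of {ν/p} ≤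
0.0012 (10⁵: 0.0085,
10⁶: 0.0027, ∼ N^{−1/2}); window counts (B): all 16 cells X ∈ {10³,10⁴,3·10⁴,10⁵}, P = X^t, t ≤ 1.5
(P ≤ 3.2·10⁷) within
2.0·√main of X·Σϱ(p)/p; Type-I sums (C): T(x) = Σ_{d≤√x}|Σ_{m≤x/d} ρ₁(dm)| = 97, 687, 1461, 3605 at
x = 10⁴, 10⁵, 3·10⁵,
10⁶ (≈ x^{0.59} vs trivial 0.50x…0.62x). A non-decaying |S_h|/N kills the target, a T(x)/x plateau
kills QuarticTypeI,
a drifting window cell kills QuarticPrimeWindow. (ii) One-hour structural check: e(hν/n), ν ∈ ℤ, is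
the Hilbert-modular
phase e(tr(ηA/n̂)) only for η ≡ h(tr n̂)⁻¹ (mod 𝔫), |η| ≍ √n; can DFI-2011-type uniformity (DFI 2011
= doi:10.1093/imrn/rnr112, Thm 1.1: h^{3/4}D^{−1/1331})
ever cover η ≍ √(modulus)? If provably not, the automorphic engine is void and only the
geometry-of-numbers variant
of the two-layer plan remains.

NUMBERS. deg 2: Σ_{p≤x} ρ_h(p) = o(π(x)), at best O(π(x)(log log x)^B/log x) (DFI 1995 p.425);
P⁺(n²+h) > n^{1.312}, window
Type I for D ≤ X^{1/2}, Type II for N ≤ X^{1/4} (arXiv:2505.00493 Thms 1.1, 1.4, 1.5); Σ_{n≤x}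
ρ_h(n) ≪ x^{3/4} (Hooley 1963)
→ x^{2/3} (Bykovskii). deg ≥ 3: (log x)^{−δ_f} over all moduli (Hooley1964); prime moduli: density
only under
Bunyakovsky (Foo2010). n⁴+1 beyond x: positive density of n ≤ X with P⁺(n⁴+1) ≥ X^{1+c_Φ}
(Delabreteche2015 Thm 1.2,
c_Φ > 0 unspecified; Φ₁₂: c = 10^{−26531}, Dartyge 2015 = Delabreteche2015 Thm 1.1; n³+2: level
X^{1+10^{−303}},
HeathBrown2001LargestPrimeFactorCubic); needed for all quartics per Delabreteche–Mestre Rem. 2: Q₁ ≥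
M^{2+ε}, Q₂ ≥ M^{1+ε}
in their Thm 3.11, proved only for Q₁Q₂ ≤ M^{3−ε}, Q₁+Q₂ ≤ M^{2−ε}. θ = 7/64 over every number field
(Blomer–Brumley
2011). h(ℚ(√2)) = h(ℚ(ζ₈)) = 1; ϱ(p) = 4 for p ≡ 1 (8), 0 for other odd p, ϱ(2) = 1, ϱ(4) = 0. Items
at open: 8
(1 target, 3 cruxes, 3 support, 1 assembly).

DEFINITION REQUESTS. None. All items are elementary over Mathlib (Nat.primesLE, Finset sums,
Complex.exp, ZMod, Int.ModEq, IsCoprime);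
no Literature fact is a hypothesis of any item. The F-side engine facts will be requested as `cite`
items
(family parity) only when the bridge child of QuarticTypeI is typed in tenure.

Novelty: Searches (2026-08-15): `lit search "Duke Friedlander Iwaniec Weyl sums for quadratic roots"` (12
local — DFI 2011
held, arXiv:2105.02854, 2107.13301, 1502.00769, 2505.00489, 2505.00493 — + 14 remote,
zbMATH/Crossref only:
OpenAlex/S2/arXiv rate-limited this session); `lit search "equidistribution roots quadratic
congruence prime moduli"`
(15 local — DFI 1995 held as paper:url-c7638613861e, arXiv:2108.05496, Homma 2008
doi:10.1016/j.jnt.2007.09.003,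
arXiv:2003.12965 — + 18 remote incl. Ngo 2024 doi:10.1112/blms.13108, Grimmelt–Merikoski
arXiv:2505.00489);
zbMATH 'roots of quadratic congruences prime moduli discrepancy' (0); plus the card's audited
searches (zbMATH ×3,
galaxy: no 'DFI/Tóth over a number field', no prime-modulus result for any quartic). Read
in-session: DFI 1995
pp.423–427, 435–441; DFI 2011 pp.1–6; arXiv:2505.00493 pp.1–4; Delabreteche2015 pp.221–224 + refs.
Nearest prior art found: DukeFriedlanderIwaniec1995 (deg 2: Props 1–2 + Theorem S — the template
transposed here);
arXiv:2505.00493 (Grimmelt–Merikoski 2025: h-uniform deg-2 window Type I/II, P⁺(n²+h) > n^{1.312});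
Delabreteche2015 with
Dartyge 2015 (the same polynomials X⁴+1, Φ₁₂: V₄ structure via resultants + geometry of numbers, P⁺
only, effective
degree-4 equidistribution requested in Rem. 2); HeathBrown2001LargestPrimeFactorCubic / Hooley 1978
(norm-form
parametrisation for n³+2); KowalskiSoundararajan2021 (prime-moduli conjecture, CRT mixing);
arXiv:2108.05496
(residues of a fixed algebraic number mod  [refs: 10.1016/j.jnt.2007.09.003, 10.1112/blms.13108, 2105.02854, 2108.05496, 2003.12965, 2505.00489, 2505.00493, paper:url-c7638613861e, doi:10.1016/j.jnt.2007.09.003, doi:10.1112/blms.13108, DukeFriedlanderIwaniec1995, KowalskiSoundararajan2021]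

Barriers (technique_class: root-equidistribution kloosterman spectral hilbert-modular): - technique_class: root-equidistribution kloosterman spectral hilbert-modular
- Literature.Barriers.Parity.SelbergParityBarrier: not engaged by any item — all items are UNSIGNED
statements about roots (ρ_h with h ≠ 0 has no main term; the window count is linear in 1_{p∣ℓ⁴+1});
VaughanGlue detects primes as MODULI of an oscillating sequence, where Vaughan + Type I/II is a
theorem, not a sieve lower bound; parity re-enters only in the continuation (μ-twisted composite
moduli), explicitly left to PolynomialMobius.
- Literature.Barriers.Parity.FordMaynardLowLevel: applies to detecting prime VALUES n⁴+1 (thin set,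
c = 3/4: Type-I level ≤ x of N = x⁴, no Type-II range); the route detects no prime values — it
supplies Type-I information at moduli BEYOND x (QuarticPrimeWindow, p ≤ x^{1+δ}), the catalogued
'specific structure' escape, and claims nothing about primes of the form n⁴+1.
- Literature.Barriers.Parity.FordMaynardMinimalTypeII: same scope remark — QuarticTypeII is bilinear
in the MODULUS mn of the root-counting function, not in a factorisation inside the value set, so the
barrier's normalisation does not apply; honest: it will apply to any later attempt to turn
QuarticPrimeWindow into primes n⁴+1.
- Literature.Barriers.Parity.FordFixedLevelBarrier: not engaged (no asymptotic for primes is drawn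
from one fixed level; the end statement is equidistribution of roots and VaughanGlue uses Type II).
- Literature.Barriers.Parity.LargeSieveLevelHalf: the level x^{1/2−ε} of QuarticTyp

History (route lifecycle, newest last):
- 2026-08-15T13:50:28Z · CLOSED retired — not-a-thesis: assembly does not conclude the sub-problem Statement (operator:999:1257524)

sub-problem: BatemanHorn · status: closed(retired) · opened planner-plancard-Parity-BatemanHorn-cyclotomi-6fd1d998-0 2026-08-15T12:23:34Z · rev 0 · ledger route-Parity-QuarticRoots
GENERATED by the gate from the ledger (D-0016/17). Provers cite these decls: `theorem foo : Summit.Parity.BatemanHorn.Theses.QuarticRoots.<Decl> := …` in Summits/Parity/BatemanHorn/Theorems/<Name>.lean.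
-/

namespace Summit.Parity.BatemanHorn.Theses.QuarticRoots

open scoped BigOperators Topology Manifold Classical MeasureTheory ProbabilityTheory Matrix InnerProductSpace ComplexConjugate ContinuousMap
open Filter Set Function TopologicalSpace MeasureTheory

attribute [summit_statement] _root_.BatemanHorn

/-- item stmt-Parity-8014 · target · rank 0 · closed · moot by None · by planner
why it might fail: DFI 1995 p.425: 'the problem for polynomials of higher degree seems to us to be very far away'; for deg ≥ 3 even the density of {ν/p} is known only under Bunyakovsky (Foo2010); = the Kowalski–Soundararajan prime-moduli conjecture at f = X⁴+1.
sources: DukeFriedlanderIwaniec1995, doi:10.4064/aa144-1-1, arXiv:2003.12965, Hooley1964, Toth2000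
[target] the end statement T (card C1, qualitative): for every integer h ≠ 0, Σ_{p ≤ P prime} Σ_{ν
mod p, ν⁴ ≡ −1} e(hν/p) = o(P/log P) (Weyl's criterion for the pairs (p, ν), whose number is ∼
π(P)). Degree-4 instance of DFI 1995; not the conjunct. -/
@[route_item "route-Parity-QuarticRoots"]
def QuarticRootsPrimeModuli : Prop :=
  ∀ h : ℤ, h ≠ 0 → (fun P : ℕ => ∑ p ∈ Nat.primesLE P, ∑ ν ∈ (Finset.range p).filter (fun ν : ℕ => p ∣ ν ^ 4 + 1), Complex.exp (2 * Real.pi * Complex.I * (h * ν / p : ℂ))) =o[Filter.atTop] fun P : ℕ => ((P : ℝ) / Real.log P : ℝ)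

/-- item stmt-Parity-8015 · crux · rank 2 · closed · moot by None · by planner
why it might fail: Hooley1964 saves only (log x)^-δ for deg ≥ 3, no level; e(hν/n) is a Hilbert-modular phase over ℚ(√2) only at an 𝔫-dependent frequency ≍ √n (ν ∈ ℤ is a half-dimensional slice of ℤ[√2]/𝔫): Kuznetsov over F would need uniformity in frequencies up to √(modulus).
sources: DukeFriedlanderIwaniec1995, Hooley1964, doi:10.1093/imrn/rnr112, arXiv:2505.00493, HeathBrown2001LargestPrimeFactorCubic, arXiv:1003.0559
[crux] DFI Proposition 1 transposed to X⁴+1 (the Type-I half of X): for every h ≠ 0 and ε > 0 there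
are δ, C > 0 such that for x ≥ 2 and every cut-off function y with y(d) ≤ x/d: Σ_{d ≤ x^{1/2−ε}}
|Σ_{m ≤ y(d)} ρ_h(dm)| ≤ C x^{1−δ}, ρ_h(n) = Σ_{ν mod n, ν⁴≡−1} e(hν/n) — power-saving
equidistribution of the roots of X⁴+1 modulo n ≡ 0 (mod d) at level x^{1/2−ε} (trivial ≍ x,
heuristic x^{3/4}; numerics j000079 (C): T(x) ≈ x^{0.59} for x ≤ 10⁶). The engine's first
deliverable: over F the sum runs over primitive ideals 𝔫 ≡ 0 (mod 𝔮) of ℤ[√2] and roots of Y² − √2Y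
+ 1. [difficulty: open-problem] -/
@[route_item "route-Parity-QuarticRoots"]
def QuarticTypeI : Prop :=
  ∀ h : ℤ, h ≠ 0 → ∀ ε : ℝ, 0 < ε → ∃ δ : ℝ, 0 < δ ∧ ∃ C : ℝ, ∀ x : ℝ, 2 ≤ x → ∀ y : ℕ → ℕ, (∀ d : ℕ, (y d : ℝ) ≤ x / d) → ∑ d ∈ Finset.Icc 1 ⌊x ^ (1 / 2 - ε)⌋₊, ‖∑ m ∈ Finset.Icc 1 (y d), ∑ ν ∈ (Finset.range (d * m)).filter (fun ν : ℕ => d * m ∣ ν ^ 4 + 1), Complex.exp (2 * Real.pi * Complex.I * (h * ν / (d * m) : ℂ))‖ ≤ C * x ^ (1 - δ)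

/-- item stmt-Parity-8016 · crux · rank 3 · closed · moot by None · by planner
why it might fail: Even for n²+1 a power saving in the balanced range N ≈ M is not in print (DFI 1995 Prop. 2: short N, β on primes; GM 2025 Thm 1.5: N ≤ X^1/4); the CRT reduction needs QuarticTypeI uniform in d ≤ x^(1−ε) and in twisted frequencies h(n₂−n₁) ≤ x.
sources: DukeFriedlanderIwaniec1995, arXiv:2505.00493, arXiv:1502.00769, KowalskiSoundararajan2021
[crux] DFI Proposition 2 transposed to X⁴+1, in the balanced range (the Type-II half of X): for
every h ≠ 0 and δ > 0 there are η, C > 0 such that for 1 ≤ N, M^δ ≤ N ≤ M and all 1-bounded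
coefficients α, β: |Σ_{M<m≤2M} Σ_{N<n≤2N} α_m β_n ρ_h(mn)| ≤ C (MN)^{1−η}. By CRT ρ_h(mn) =
Σ_{ν₁,ν₂} e(hν₁n̄/m) e(hν₂m̄/n) for (m,n) = 1: bilinear forms with root-weighted Kloosterman
fractions; DFI 1995 p.425 call ‖α‖‖β‖(M+N)^{1/2}(hMN)^ε 'plausible' and prove a shorter range with β
on primes. [deps: QuarticTypeI] [difficulty: open-problem] -/
@[route_item "route-Parity-QuarticRoots"]
def QuarticTypeII : Prop :=
  ∀ h : ℤ, h ≠ 0 → ∀ δ : ℝ, 0 < δ → ∃ η : ℝ, 0 < η ∧ ∃ C : ℝ, ∀ M N : ℝ, 1 ≤ N → M ^ δ ≤ N → N ≤ M → ∀ α β : ℕ → ℂ, (∀ m, ‖α m‖ ≤ 1) → (∀ n, ‖β n‖ ≤ 1) → ‖∑ m ∈ Finset.Ioc ⌊M⌋₊ ⌊2 * M⌋₊, ∑ n ∈ Finset.Ioc ⌊N⌋₊ ⌊2 * N⌋₊, α m * β n * ∑ ν ∈ (Finset.range (m * n)).filter (fun ν : ℕ => m * n ∣ ν ^ 4 + 1),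 Complex.exp (2 * Real.pi * Complex.I * (h * ν / (m * n) : ℂ))‖ ≤ C * (M * N) ^ (1 - η)

/-- item stmt-Parity-8017 · crux · rank 4 · closed · moot by None · by planner
why it might fail: Needs Weyl sums uniform in h ≤ P/X ≈ X^δ, where the reciprocity error O(h·p^-1/2) bites, plus Type II to reach primes; for n⁴+1 only geometry of numbers goes beyond X (P⁺ ≥ X^(1+c) on a positive density, Delabreteche2015 Thm 1.2; Φ₁₂: c = 10^-26531) — never prime moduli.
sources: doi:10.4064/aa169-3-2, arXiv:2505.00493, HeathBrown2001LargestPrimeFactorCubic, DeshouillersIwaniec1982, MarklofWelsh2023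
[crux] card C2/C4, the consumable rung: there are δ, C > 0 such that for 2 ≤ X ≤ P ≤ X^{1+δ}:
|Σ_{P<p≤2P prime} (#{1 ≤ ℓ ≤ X : p ∣ ℓ⁴+1} − X·ϱ(p)/p)| ≤ C X^{1−δ}, ϱ(p) = #{ν mod p : ν⁴ ≡ −1}
(main term ≍ X/log X, fluctuation heuristic √X; numerics j000079 (B): within 2√main up to P =
X^{1.5}, X ≤ 10⁵). Equidistribution of ν/p at the shrinking scale X/P over PRIME moduli just beyond
X: the prime slice d = p ∈ (x, x^{1+δ}] of the Möbius tail of n⁴+1 (μ(p) = −1 constant ⇒ unsigned)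
and the Dickman-type law for P⁺(n⁴+1) near exponent 1. [deps: QuarticTypeI, QuarticTypeII]
[difficulty: open-problem] -/
@[route_item "route-Parity-QuarticRoots"]
def QuarticPrimeWindow : Prop :=
  ∃ δ : ℝ, 0 < δ ∧ ∃ C : ℝ, ∀ X P : ℝ, 2 ≤ X → X ≤ P → P ≤ X ^ (1 + δ) → |∑ p ∈ (Finset.Ioc ⌊P⌋₊ ⌊2 * P⌋₊).filter Nat.Prime, ((((Finset.Icc 1 ⌊X⌋₊).filter (fun ℓ : ℕ => p ∣ ℓ ^ 4 + 1)).card : ℝ) - X * (((Finset.range p).filter (fun ν : ℕ => p ∣ ν ^ 4 + 1)).card : ℝ) / p)| ≤ C * X ^ (1 - δ)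

/-- item stmt-Parity-8018 · support · rank 9 · closed · moot by None · by planner
sources: Vaughan1980, IwaniecKowalski2004, DukeFriedlanderIwaniec1995
[support] sequence-agnostic glue (known method, provable with effort): for c : ℕ → ℂ with |c(n)| ≤
τ(n)², Type I at level x^{1/2−ε} with a power saving (sup-over-length form) and Type II with a power
saving whenever M^δ ≤ N ≤ M imply Σ_{p≤P} c(p) = o(P/log P). Proof: Vaughan's identity with U = V =
P^{δ₀} (in tree: Literature.NumberTheory.Sieve.VaughanMeanValueDecomposition,
vonMangoldt_eq_four_terms), Type I pieces by partial summation (level P^{2δ₀} ≤ P^{1/2−ε}), Type II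
pieces after dyadic decomposition and Perron separation of mn ≤ P (twists m^{it}, n^{it} keep
coefficients 1-bounded), τ-bounds ≤ P^ε against the power saving, prime powers trivially, partial
summation from Λ to primes. [difficulty: L] -/
@[route_item "route-Parity-QuarticRoots"]
def VaughanGlue : Prop :=
  ∀ c : ℕ → ℂ, (∀ n : ℕ, ‖c n‖ ≤ ((Nat.divisors n).card : ℝ) ^ 2) → (∀ ε : ℝ, 0 < ε → ∃ δ : ℝ, 0 < δ ∧ ∃ C : ℝ, ∀ x : ℝ, 2 ≤ x → ∀ y : ℕ → ℕ, (∀ d : ℕ, (y d : ℝ) ≤ x / d) → ∑ d ∈ Finset.Icc 1 ⌊x ^ (1 / 2 - ε)⌋₊, ‖∑ m ∈ Finset.Icc 1 (y d), c (d * m)‖ ≤ C * x ^ (1 - δ)) → (∀ δ : ℝ, 0 < δ → ∃ η : ℝ, 0 < η ∧ ∃ C : ℝ, ∀ M N : ℝ, 1 ≤ N → M ^ δ ≤ N → N ≤ M → ∀ α β : ℕ → ℂ, (∀ m, ‖α m‖ ≤ 1) → (∀ n, ‖β n‖ ≤ 1) → ‖∑ m ∈ Finset.Ioc ⌊M⌋₊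 ⌊2 * M⌋₊, ∑ n ∈ Finset.Ioc ⌊N⌋₊ ⌊2 * N⌋₊, α m * β n * c (m * n)‖ ≤ C * (M * N) ^ (1 - η)) → (fun P : ℕ => ∑ p ∈ Nat.primesLE P, c p) =o[Filter.atTop] fun P : ℕ => ((P : ℝ) / Real.log P : ℝ)

/-- item stmt-Parity-8019 · support · rank 9 · closed · moot by None · by planner
sources: doi:10.4064/aa169-3-2, Toth2000
[support] the dictionary lemma at primes: in 𝔽_p with s² = 2, ν⁴ + 1 = 0 ↔ (ν² − sν + 1 = 0 ∨ ν² +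
sν + 1 = 0), from X⁴+1 = (X² − sX + 1)(X² + sX + 1); i.e. the roots of X⁴+1 mod p ≡ ±1 (8) are the
roots of the CM relative quadratic g = Y² − √2·Y + 1 of ℚ(ζ₈)/ℚ(√2) read at the two degree-one
primes of ℤ[√2] above p (√2 ↦ ±s). Provable now (ring identity + no zero divisors). [difficulty:
provable-now] -/
@[route_item "route-Parity-QuarticRoots"]
def TowerSplitting : Prop :=
  ∀ (p : ℕ) [Fact p.Prime] (s ν : ZMod p), s ^ 2 = 2 → (ν ^ 4 + 1 = 0 ↔ ν ^ 2 - s * ν + 1 = 0 ∨ ν ^ 2 + s * ν + 1 = 0)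

/-- item stmt-Parity-8020 · support · rank 9 · closed · moot by None · by planner
sources: DukeFriedlanderIwaniec1995, Toth2000
[support] the card's reciprocity step as an exact identity: for ε = ±1, p = ε(c² − 2d²) > 0, d ≠ 0,
gcd(c, d) = 1, p ∣ dν − (dA₀ − cA₁) (i.e. ν ≡ A₀ + A₁√2 with √2 ≡ −c/d mod p) and c·c̄ ≡ 1 (mod d):
ν/p ≡ A₀/p + ε·A₁·c̄/d − A₁c/(dp) (mod 1). With c + d√2 in a fixed fundamental domain for the unit
1+√2 (|c|, |d| ≍ √p) and a short representative |Aᵢ| ≪ √p this is ν/p = εA₁c̄/d + O(p^{−1/2}): a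
Kloosterman fraction of modulus d ≍ √p (DFI, n²+1: ν/p = −s̄/r + O(1/p)). Checked numerically
in-session (p = 17 = 5²−2·2², ν = 8, A = 2+√2; p = 7, ε = −1). Provable now (two-term reciprocity
d̄/p + p̄/d ≡ 1/(dp), p ≡ εc² mod d). [difficulty: provable-now] -/
@[route_item "route-Parity-QuarticRoots"]
def RootReciprocity : Prop :=
  ∀ (ε c d A₀ A₁ ν cbar : ℤ) (p : ℕ), (ε = 1 ∨ ε = -1) → (p : ℤ) = ε * (c ^ 2 - 2 * d ^ 2) → 0 < p → d ≠ 0 → IsCoprime c d → (p : ℤ) ∣ d * ν - (d * A₀ - c * A₁) → c * cbar ≡ 1 [ZMOD d] → ∃ k : ℤ, (ν : ℝ) / p = k + A₀ / p + ε * A₁ * cbar / d - A₁ * c / (d * p)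

/-- item stmt-Parity-8021 · assembly · rank 1 · closed · moot by None · by planner
sources: DukeFriedlanderIwaniec1995, Vaughan1980
[assembly] QuarticTypeI → QuarticTypeII → VaughanGlue → QuarticRootsPrimeModuli (instantiate the
glue at c = ρ_h for each h ≠ 0; provable now given the root-count bound). -/
@[route_item "route-Parity-QuarticRoots"]
def Assembly : Prop :=
  QuarticTypeI → QuarticTypeII → VaughanGlue → QuarticRootsPrimeModuli

end Summit.Parity.BatemanHorn.Theses.QuarticRoots
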